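/-
Copyright (c) 2026. All rights reserved.
Released under Apache 2.0 license as described in the file LICENSE.
-/
import Literature.AlgebraicGeometry.Pohlmann1968.DegenerateCMTypesAbelianCMFieldPrimePowerRankGap
import HarnessLib

/-!
# `p − 1` divides the defect: the vanishing odd characters of a CM type of an abelian group of order `2p^k`
# come in Galois classes `{χᵃ}` of size `φ(p^{j+1})` — every CM type of an abelian CM field of degree `2·3^k`
# has even rank

Sequel to `DegenerateCMTypesAbelianCMFieldPrimePowerRankGap` (the powers `χᵃ`, `a` prime to `2p^{j+1}`, of a
vanishing odd character vanish).  Here the classes are counted exactly: `χᵃ = χᵇ` iff `a ≡ b (mod 2p^{j+1})`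
(`a, b` odd), so the class `{χᵃ : a prime to 2p^k}` of a vanishing odd character has `φ(2p^{j+1}) = p^j(p − 1)`
elements; the classes partition the set of vanishing odd characters; hence **`p − 1` divides Kubota's defect
`#{χ odd : χ(S) = 0} = p^k + 1 − rank(S)`**.  For `p = 3`: every CM type of an abelian CM field of degree
`2·3^k` has EVEN rank (dimension `9`: `10, 8, 6, 4, 2` — B. Dodson [Dodson1987], Remark 4.7; dimension `27`:
`28, 26, 22, 20, 10, 8, 4, 2` for the cyclic fields); for `p = 5`, degree `250`: rank `≡ 2 (mod 4)`.
T. Kubota [Kubota1965], §4 Lemma 2.  THEOREMS ONLY.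

## What is proved

* §1 (group level) **`char_pow_eq_pow_iff`** (`χᵃ = χᵇ ⟺ a ≡ b (mod 2p^{j+1})`), **`card_powClass`** (the class has
  `p^j(p − 1)` elements), **`sub_one_dvd_ncard_oddChar_vanishing`** (`p − 1 ∣ #{χ odd : χ(S) = 0}`),
  **`sub_one_dvd_sub_typeRank`** (`p − 1 ∣ p^k + 1 − rank`).
* §2 (abelian CM fields of degree `2p^k`) **`sub_one_dvd_sub_cmTypeRank`**, `sub_one_dvd_sub_cmTypeRank'`
  (coordinate-free), **`even_cmTypeRank_three`** (`p = 3`: even rank), `cmTypeRank_mod_four_twoHundredFifty`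
  (`p = 5`, degree `250`: rank `≡ 2 mod 4`).

## References

* [Kubota1965] T. Kubota, Trans. AMS 118 (1965), §4 Lemma 2.
* [Dodson1987] B. Dodson, J. Algebra 111 (1987): Thm. 1.12, Remark 4.7.

## Provenance

Lane `lit-hodgefound` (Track 2, Layer A3/B), seat `lit-hodgefound-p10` generation 35, row g35-#20; neighbours
cited by name, nothing restated: `DegenerateCMTypesAbelianCMFieldPrimePowerRankGap` (`sum_char_pow_eq_zero_iff`),
`DegenerateCMTypesAbelianPrimePower` (`exists_isPrimitiveRoot_of_sum_char_eq_zero`), `CMTypeRankCharacters`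
(Kubota), `DegenerateCMTypesCompositeDimension` (`ncard_oddChar`).
-/

open scoped BigOperators NumberField IsMulCommutative Classical
open CategoryTheory NumberField

namespace Literature.AlgebraicGeometry.Pohlmann1968

namespace AbelianPrimePower

open Literature.NumberTheory.ComplexMultiplication
open Literature.NumberTheory.ComplexMultiplication.CyclicCMType
open Literature.NumberTheory.ComplexMultiplication.CyclicCMType.AbelianPrimePow
open Literature.AlgebraicGeometry.Motives (AbelianVariety CMType)
open Literature.AlgebraicGeometry.HodgeTheory
open Literature.AlgebraicGeometry.ComplexMultiplication (IsCMTypeRealisation)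
open Literature.AlgebraicGeometry.Pohlmann1968.CyclicTwoOddPrimes (gal_comm isCMTypeWith_galType
  cmTypeRank_eq_typeRank_galType)
open Literature.AlgebraicGeometry.ComplexMultiplication.CyclicTwoPower (exists_conj_gal)
open Dodson1984 (ncard_oddChar)

/-! ## §1 Group level: the vanishing odd characters come in classes `{χᵃ}` of size `φ(p^{j+1})` -/

section Group

variable {G : Type*} [CommGroup G] [Fintype G] [DecidableEq G] {p : ℕ} [hp : Fact p.Prime] {ρ : G} {Φ : Finset G}

omit [Fintype G] [DecidableEq G] hp in
/-- `χ(g^e) = χ(g)^e`. [folklore] -/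
private theorem char_pow (χ : AddChar (Additive G) ℂ) (g : G) (e : ℕ) :
    χ (Additive.ofMul (g ^ e)) = χ (Additive.ofMul g) ^ e := by
  rw [ofMul_pow, AddChar.map_nsmul_eq_pow]

omit [DecidableEq G] hp in
/-- `χ^{|G|} = 1`, hence `χᵃ = χ^{a mod |G|}` and `χ^{ab} = …`. [folklore] -/
private theorem char_pow_card_eq_one (χ : AddChar (Additive G) ℂ) : χ ^ Fintype.card G = 1 := by
  ext a
  rw [AddChar.pow_apply, AddChar.one_apply, ← AddChar.map_nsmul_eq_pow,
    show Fintype.card G • a = Additive.ofMul (Additive.toMul a ^ Fintype.card G) from rfl, pow_card_eq_one,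
    ofMul_one, AddChar.map_zero_eq_one]

omit [DecidableEq G] hp in
/-- `χᵃ = χ^{a mod |G|}`. [folklore] -/
private theorem char_pow_mod (χ : AddChar (Additive G) ℂ) (a : ℕ) : χ ^ (a % Fintype.card G) = χ ^ a := by
  conv_rhs => rw [← Nat.mod_add_div a (Fintype.card G), pow_add, pow_mul, char_pow_card_eq_one, one_pow, mul_one]

omit [Fintype G] [DecidableEq G] hp in
/-- `ωᵃ = ωᵇ` for a primitive `n`-th root of unity `ω` forces `a ≡ b (mod n)`. [folklore] -/
private theorem modEq_of_pow_eq_pow' {ω : ℂ} {n : ℕ} (hn : n ≠ 0) (hω : IsPrimitiveRoot ω n) {a b : ℕ}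
    (h : ω ^ a = ω ^ b) : a ≡ b [MOD n] := by
  wlog hab : a ≤ b generalizing a b
  · exact (this h.symm (le_of_not_ge hab)).symm
  obtain ⟨c, rfl⟩ := Nat.exists_eq_add_of_le hab
  rw [pow_add] at h
  have hne : ω ^ a ≠ 0 := pow_ne_zero _ (hω.ne_zero hn)
  have h1 : ω ^ c = 1 := (mul_eq_left₀ hne).1 h.symm
  refine (Nat.modEq_iff_dvd' hab).2 ?_
  rw [Nat.add_sub_cancel_left]
  exact (hω.pow_eq_one_iff_dvd c).1 h1

omit [Fintype G] [DecidableEq G] hp in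
/-- `gcd(N, a mod N) = gcd(N, a)`. [folklore] -/
private theorem coprime_mod_iff {N a : ℕ} : N.Coprime (a % N) ↔ N.Coprime a := by
  rw [Nat.Coprime, Nat.Coprime, Nat.gcd_comm N (a % N), ← Nat.gcd_rec]

omit [Fintype G] [DecidableEq G] hp in
/-- `a` is prime to `2p^m` (`m ≥ 1`) iff `a` is odd and prime to `p`. [folklore] -/
private theorem coprime_two_mul_pow_iff {m a : ℕ} (hm : 0 < m) : (2 * p ^ m).Coprime a ↔ Odd a ∧ p.Coprime a := by
  rw [Nat.coprime_mul_iff_left, Nat.coprime_pow_left_iff hm, Nat.coprime_two_left]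

omit [Fintype G] [DecidableEq G] in
/-- **`χᵃ = χᵇ` iff `a ≡ b (mod 2p^{j+1})`** for an odd character with values in `μ_{2p^{j+1}}` containing a
primitive `p^{j+1}`-th root of unity `χ(u)`, `a, b` odd. [cite: Kubota1965, §4 Lemma 2 (proof)] -/
theorem char_pow_eq_pow_iff (hp2 : p ≠ 2) (χ : AddChar (Additive G) ℂ) {u : G} {j : ℕ}
    (hu : IsPrimitiveRoot (χ (Additive.ofMul u)) (p ^ (j + 1)))
    (hall : ∀ g : G, χ (Additive.ofMul g) ^ (2 * p ^ (j + 1)) = 1) {a b : ℕ} (ha : Odd a) (hb : Odd b) :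
    χ ^ a = χ ^ b ↔ a ≡ b [MOD 2 * p ^ (j + 1)] := by
  have hoddn : Odd (p ^ (j + 1)) := (hp.out.odd_of_ne_two hp2).pow
  constructor
  · intro hab
    have hu' := congrArg (fun ψ : AddChar (Additive G) ℂ => ψ (Additive.ofMul u)) hab
    simp only [AddChar.pow_apply] at hu'
    have h1 : a ≡ b [MOD p ^ (j + 1)] := modEq_of_pow_eq_pow' (pow_ne_zero _ hp.out.ne_zero) hu hu'
    have h2 : a ≡ b [MOD 2] := by rw [Nat.ModEq, Nat.odd_iff.1 ha, Nat.odd_iff.1 hb]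
    exact (Nat.modEq_and_modEq_iff_modEq_mul (Nat.coprime_two_left.2 hoddn)).1 ⟨h2, h1⟩
  · intro hab
    ext g
    rw [AddChar.pow_apply, AddChar.pow_apply]
    wlog hle : a ≤ b generalizing a b
    · exact (this hb ha hab.symm (le_of_not_ge hle)).symm
    obtain ⟨c, rfl⟩ := Nat.exists_eq_add_of_le hle
    have hdvd : 2 * p ^ (j + 1) ∣ c := by
      have := (Nat.modEq_iff_dvd' hle).1 hab
      rwa [Nat.add_sub_cancel_left] at this
    obtain ⟨d, rfl⟩ := hdvd
    rw [pow_add, pow_mul, show χ g ^ (2 * p ^ (j + 1)) = 1 from hall (Additive.toMul g), one_pow, mul_one]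

omit [DecidableEq G] in
/-- **The class `{χᵃ : a prime to 2p^k}` of a vanishing odd character has `φ(p^{j+1}) = p^j(p − 1)` elements**
(`|G| = 2p^k`; `χ(u)` a primitive `p^{j+1}`-th root of unity of maximal level).
[cite: Kubota1965, §4 Lemma 2] [cite: Dodson1987, Thm. 1.12 (proof)] -/
theorem card_powClass (hp2 : p ≠ 2) {k : ℕ} (hcard : Fintype.card G = 2 * p ^ k) (χ : AddChar (Additive G) ℂ)
    {u : G} {j : ℕ} (hu : IsPrimitiveRoot (χ (Additive.ofMul u)) (p ^ (j + 1)))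
    (hall : ∀ g : G, χ (Additive.ofMul g) ^ (2 * p ^ (j + 1)) = 1) :
    (((Finset.range (2 * p ^ k)).filter fun a => (2 * p ^ k).Coprime a).image fun a => χ ^ a).card =
      p ^ j * (p - 1) := by
  set n := p ^ (j + 1) with hn
  have hp0 := hp.out.pos
  have hoddn : Odd n := (hp.out.odd_of_ne_two hp2).pow
  -- `j + 1 ≤ k`: `χ(u)^{2p^k} = 1`
  have hjk : j + 1 ≤ k := by
    have h1 : χ (Additive.ofMul u) ^ (2 * p ^ k) = 1 := by rw [← hcard, ← char_pow, pow_card_eq_one, ofMul_one,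
      AddChar.map_zero_eq_one]
    have h2 : n ∣ 2 * p ^ k := (hu.pow_eq_one_iff_dvd _).1 h1
    have h3 : n ∣ p ^ k := (Nat.Coprime.dvd_of_dvd_mul_left (Nat.coprime_two_right.2 hoddn) h2)
    exact (Nat.pow_dvd_pow_iff_le_right hp.out.one_lt).1 h3
  -- the images over `a < 2p^k` coprime are the images over `a < 2n` coprime
  set Tk : Finset ℕ := (Finset.range (2 * p ^ k)).filter fun a => (2 * p ^ k).Coprime a with hTk
  set Tn : Finset ℕ := (Finset.range (2 * n)).filter fun a => (2 * n).Coprime a with hTn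
  have hcop : ∀ a : ℕ, (2 * p ^ k).Coprime a ↔ (2 * n).Coprime a := by
    intro a
    rw [coprime_two_mul_pow_iff (by omega), hn, coprime_two_mul_pow_iff (Nat.succ_pos j)]
  have himage : Tk.image (fun a => χ ^ a) = Tn.image fun a => χ ^ a := by
    ext ψ
    simp only [Finset.mem_image, hTk, hTn, Finset.mem_filter, Finset.mem_range]
    constructor
    · rintro ⟨a, ⟨-, ha⟩, rfl⟩
      have ha' := (hcop a).1 ha
      refine ⟨a % (2 * n), ⟨Nat.mod_lt _ (by positivity), coprime_mod_iff.2 ha'⟩, ?_⟩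
      · have hodd : Odd a := Nat.coprime_two_left.1 ha'.coprime_mul_right
        have hodd' : Odd (a % (2 * n)) := by
          rw [Nat.odd_iff, Nat.mod_mul_right_mod, ← Nat.odd_iff]; exact hodd
        exact (char_pow_eq_pow_iff hp2 χ hu hall hodd' hodd).2 (Nat.mod_modEq _ _)
    · rintro ⟨a, ⟨ha, ha'⟩, rfl⟩
      have hlt : a < 2 * p ^ k := lt_of_lt_of_le ha
        (Nat.mul_le_mul_left 2 (Nat.pow_le_pow_right hp0 hjk))
      exact ⟨a, ⟨hlt, (hcop a).2 ha'⟩, rfl⟩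
  have hinj : Set.InjOn (fun a : ℕ => χ ^ a) ↑Tn := by
    intro a ha b hb hab
    rw [hTn, Finset.coe_filter, Set.mem_setOf_eq, Finset.mem_range] at ha hb
    have hao : Odd a := Nat.coprime_two_left.1 ha.2.coprime_mul_right
    have hbo : Odd b := Nat.coprime_two_left.1 hb.2.coprime_mul_right
    exact Nat.ModEq.eq_of_lt_of_lt ((char_pow_eq_pow_iff hp2 χ hu hall hao hbo).1 hab) ha.1 hb.1
  rw [himage, Finset.card_image_of_injOn hinj, hTn, ← Nat.totient_eq_card_coprime,
    Nat.totient_mul (Nat.coprime_two_left.2 hoddn), Nat.totient_two, one_mul, hn, Nat.totient_prime_pow_succ hp.out]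

/-- **`p − 1` DIVIDES THE DEFECT**: on an abelian group of order `2p^k` (`p` odd) the number of odd characters
vanishing on a CM type is a multiple of `p − 1` — the vanishing set is a union of the classes `{χᵃ}`, of sizes
`p^j(p − 1)`.  Hence `p − 1 ∣ p^k + 1 − rank(S)`. [cite: Kubota1965, §4 Lemma 2] [cite: Dodson1987, Thm. 1.12 (proof)] -/
theorem sub_one_dvd_ncard_oddChar_vanishing (hp2 : p ≠ 2) {k : ℕ} (hcard : Fintype.card G = 2 * p ^ k)
    (h : IsCMTypeWith ρ (Φ : Set G)) :
    p - 1 ∣ {χ : AddChar (Additive G) ℂ | χ (Additive.ofMul ρ) = -1 ∧ ∑ s ∈ Φ, χ (Additive.ofMul s) = 0}.ncard := by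
  set V : Finset (AddChar (Additive G) ℂ) := Finset.univ.filter fun χ =>
    χ (Additive.ofMul ρ) = -1 ∧ ∑ s ∈ Φ, χ (Additive.ofMul s) = 0 with hV
  have hVS : {χ : AddChar (Additive G) ℂ | χ (Additive.ofMul ρ) = -1 ∧ ∑ s ∈ Φ, χ (Additive.ofMul s) = 0}.ncard =
      V.card := by
    rw [← Set.ncard_coe_finset]; congr 1; ext χ; simp [hV]
  rw [hVS]
  set T : Finset ℕ := (Finset.range (2 * p ^ k)).filter fun a => (2 * p ^ k).Coprime a with hT
  set cl : AddChar (Additive G) ℂ → Finset (AddChar (Additive G) ℂ) := fun χ => T.image fun a => χ ^ a with hcl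
  have hN : 1 < 2 * p ^ k := by have := pow_pos hp.out.pos k; omega
  have hoddk : Odd (p ^ k) := (hp.out.odd_of_ne_two hp2).pow
  -- `T` is closed under products and inverses modulo `2p^k`, and contains `1`
  have h1T : 1 ∈ T := by
    rw [hT, Finset.mem_filter, Finset.mem_range]; exact ⟨hN, Nat.coprime_one_right _⟩
  have hmulT : ∀ a ∈ T, ∀ b ∈ T, a * b % (2 * p ^ k) ∈ T := by
    intro a ha b hb
    rw [hT, Finset.mem_filter, Finset.mem_range] at ha hb ⊢
    exact ⟨Nat.mod_lt _ (by omega), coprime_mod_iff.2 (Nat.Coprime.mul_right ha.2 hb.2)⟩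
  have hinvT : ∀ a ∈ T, ∃ b ∈ T, a * b % (2 * p ^ k) = 1 := by
    intro a ha
    rw [hT, Finset.mem_filter, Finset.mem_range] at ha
    obtain ⟨m, hm, hm1⟩ := Nat.exists_mul_mod_eq_one_of_coprime ha.2.symm hN
    refine ⟨m, ?_, hm1⟩
    rw [hT, Finset.mem_filter, Finset.mem_range]
    refine ⟨hm, ?_⟩
    have ham : (2 * p ^ k).Coprime (a * m) := by
      rw [← coprime_mod_iff, hm1]; exact Nat.coprime_one_right _
    exact (Nat.coprime_mul_iff_right.1 ham).2
  -- powers modulo `|G| = 2p^k`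
  have hpowmod : ∀ (χ : AddChar (Additive G) ℂ) (x : ℕ), χ ^ (x % (2 * p ^ k)) = χ ^ x := by
    intro χ x; rw [← hcard]; exact char_pow_mod χ x
  -- every class member is an odd vanishing character
  have hclsub : ∀ χ ∈ V, cl χ ⊆ V := by
    intro χ hχV ψ hψ
    rw [hV, Finset.mem_filter] at hχV
    obtain ⟨-, hχ, h0⟩ := hχV
    rw [hcl] at hψ
    obtain ⟨a, ha, rfl⟩ := Finset.mem_image.1 hψ
    rw [hT, Finset.mem_filter] at ha
    obtain ⟨u, j, hu, hall⟩ := exists_isPrimitiveRoot_of_sum_char_eq_zero hp2 hcard h χ h0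
    have hjk : 0 < k := by
      -- `p^{j+1} ∣ 2p^k` forces `k ≥ 1`
      have h1 : χ (Additive.ofMul u) ^ (2 * p ^ k) = 1 := by
        rw [← hcard, ← char_pow, pow_card_eq_one, ofMul_one, AddChar.map_zero_eq_one]
      have h2 : p ^ (j + 1) ∣ 2 * p ^ k := (hu.pow_eq_one_iff_dvd _).1 h1
      have h3 : p ^ (j + 1) ∣ p ^ k :=
        Nat.Coprime.dvd_of_dvd_mul_left (Nat.coprime_two_right.2 (hp.out.odd_of_ne_two hp2).pow) h2
      have := (Nat.pow_dvd_pow_iff_le_right hp.out.one_lt).1 h3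
      omega
    have ha' : (2 * p ^ (j + 1)).Coprime a := by
      rw [coprime_two_mul_pow_iff (Nat.succ_pos j)]
      exact (coprime_two_mul_pow_iff hjk).1 ha.2
    have hodd : Odd a := ((coprime_two_mul_pow_iff hjk).1 ha.2).1
    rw [hV, Finset.mem_filter]
    exact ⟨Finset.mem_univ _, by rw [AddChar.pow_apply, hχ, hodd.neg_one_pow],
      (sum_char_pow_eq_zero_iff hp2 h χ hχ hu hall ha').2 h0⟩
  have hclmem : ∀ χ : AddChar (Additive G) ℂ, χ ∈ cl χ := fun χ =>
    Finset.mem_image.2 ⟨1, h1T, pow_one χ⟩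
  have hcleq : ∀ χ : AddChar (Additive G) ℂ, ∀ χ' ∈ cl χ, cl χ' = cl χ := by
    intro χ χ' hχ'
    obtain ⟨a, ha, rfl⟩ := Finset.mem_image.1 hχ'
    obtain ⟨a', ha', haa'⟩ := hinvT a ha
    ext ψ
    simp only [hcl, Finset.mem_image]
    constructor
    · rintro ⟨b, hb, rfl⟩
      exact ⟨a * b % (2 * p ^ k), hmulT a ha b hb, by rw [hpowmod, pow_mul]⟩
    · rintro ⟨b, hb, rfl⟩
      refine ⟨a' * b % (2 * p ^ k), hmulT a' ha' b hb, ?_⟩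
      rw [← pow_mul, ← hpowmod χ (a * (a' * b % (2 * p ^ k))), ← hpowmod χ b]
      congr 1
      have h1 : a * (a' * b % (2 * p ^ k)) ≡ a * (a' * b) [MOD 2 * p ^ k] :=
        (Nat.mod_modEq _ _).mul_left a
      have h2 : a * (a' * b) ≡ 1 * b [MOD 2 * p ^ k] := by
        rw [← mul_assoc]
        exact Nat.ModEq.mul_right b (by rw [Nat.ModEq, haa', Nat.one_mod_eq_one.2 hN.ne'])
      rw [one_mul] at h2
      exact h1.trans h2
  -- the fibres of `cl` on `V` are the classes
  have hfib : ∀ χ₀ ∈ V, V.filter (fun χ => cl χ = cl χ₀) = cl χ₀ := by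
    intro χ₀ hχ₀
    ext χ
    rw [Finset.mem_filter]
    constructor
    · rintro ⟨-, hc⟩; rw [← hc]; exact hclmem χ
    · intro hχ; exact ⟨hclsub χ₀ hχ₀ hχ, hcleq χ₀ χ hχ⟩
  -- each class has size `p^j (p − 1)`
  have hsize : ∀ χ ∈ V, p - 1 ∣ (cl χ).card := by
    intro χ hχV
    rw [hV, Finset.mem_filter] at hχV
    obtain ⟨u, j, hu, hall⟩ := exists_isPrimitiveRoot_of_sum_char_eq_zero hp2 hcard h χ hχV.2.2
    rw [hcl]
    show p - 1 ∣ (T.image fun a => χ ^ a).card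
    rw [hT, card_powClass hp2 hcard χ hu hall]
    exact Dvd.intro_left _ rfl
  rw [Finset.card_eq_sum_card_fiberwise (f := cl) (t := V.image cl) fun χ hχ => Finset.mem_image_of_mem cl hχ]
  refine Finset.dvd_sum fun c hc => ?_
  obtain ⟨χ₀, hχ₀, rfl⟩ := Finset.mem_image.1 hc
  rw [hfib χ₀ hχ₀]
  exact hsize χ₀ hχ₀

/-- **`p − 1 ∣ p^k + 1 − rank(S)`** for every CM type of an abelian group of order `2p^k` (`p` odd).
[cite: Kubota1965, §4 Lemma 2] [cite: Dodson1987, Thm. 1.12 and Remark 4.7] -/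
theorem sub_one_dvd_sub_typeRank (hp2 : p ≠ 2) {k : ℕ} (hcard : Fintype.card G = 2 * p ^ k)
    (h : IsCMTypeWith ρ (Φ : Set G)) :
    typeRank G (Φ : Set G) ≤ p ^ k + 1 ∧ p - 1 ∣ p ^ k + 1 - typeRank G (Φ : Set G) := by
  have hρ1 : ρ ≠ 1 := by
    intro h1; have := h.rho_smul_ne (1 : G); rw [h1, smul_eq_mul, one_mul] at this; exact this rfl
  have hρ2 : ρ * ρ = 1 := by have := h.invol (1 : G); simpa [smul_eq_mul] using this
  have hkub := h.typeRank_add_ncard_oddCharacters_vanishing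
  rw [ncard_oddChar hρ1 hρ2 hcard] at hkub
  have hdvd := sub_one_dvd_ncard_oddChar_vanishing hp2 hcard h
  refine ⟨by omega, ?_⟩
  have e : p ^ k + 1 - typeRank G (Φ : Set G) =
      {χ : AddChar (Additive G) ℂ | χ (Additive.ofMul ρ) = -1 ∧ ∑ s ∈ Φ, χ (Additive.ofMul s) = 0}.ncard := by
    omega
  rw [e]; exact hdvd

end Group

/-! ## §2 Abelian CM fields of degree `2p^k`: `p − 1` divides `p^k + 1 − Rank(Φ)` -/

section Field

variable {K : Type} [Field K] [NumberField K] [IsCMField K] [Normal ℚ K] [IsMulCommutative (K ≃ₐ[ℚ] K)]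
variable {p : ℕ} [hp : Fact p.Prime] {k : ℕ} {ρ : K ≃ₐ[ℚ] K} {φ₀ : K →+* ℂ}

omit [IsCMField K] in
/-- **`p − 1 ∣ p^k + 1 − Rank(Φ)`** for every CM type of an abelian CM field of degree `2p^k` (`p` odd): the defect
is a sum of class sizes `p^j(p − 1)`. [cite: Kubota1965, §4 Lemma 2] [cite: Dodson1987, Thm. 1.12 and Remark 4.7] -/
theorem sub_one_dvd_sub_cmTypeRank (hp2 : p ≠ 2) (hρ : ∀ x, φ₀ (ρ x) = starRingEnd ℂ (φ₀ x))
    (hK : Module.finrank ℚ K = 2 * p ^ k) (Φ : CMType K) :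
    cmTypeRank Φ ≤ p ^ k + 1 ∧ p - 1 ∣ p ^ k + 1 - cmTypeRank Φ := by
  have hcardG : Fintype.card (K ≃ₐ[ℚ] K) = 2 * p ^ k := by rw [card_gal_eq_finrank φ₀, hK]
  rw [cmTypeRank_eq_typeRank_galType Φ φ₀]
  exact sub_one_dvd_sub_typeRank hp2 hcardG (isCMTypeWith_galType hρ Φ)

omit hp in
/-- **Coordinate-free.** [cite: Kubota1965, §4 Lemma 2] [cite: Dodson1987, Remark 4.7] -/
theorem sub_one_dvd_sub_cmTypeRank' (hprime : p.Prime) (hp2 : p ≠ 2) (hK : Module.finrank ℚ K = 2 * p ^ k)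
    (Φ : CMType K) : cmTypeRank Φ ≤ p ^ k + 1 ∧ p - 1 ∣ p ^ k + 1 - cmTypeRank Φ := by
  haveI : Fact p.Prime := ⟨hprime⟩
  obtain ⟨φ₀⟩ := (inferInstance : Nonempty (K →+* ℂ))
  obtain ⟨ρ, hρall⟩ := exists_conj_gal (K := K)
  exact sub_one_dvd_sub_cmTypeRank hp2 (hρall φ₀) hK Φ

omit hp in
/-- **`p = 3`: every CM type of an abelian CM field of degree `2·3^k` has EVEN rank** (dimension `9`:
`10, 8, 6, 4, 2`; dimension `27`: `28, 26, 22, 20, 10, 8, 4, 2` in the cyclic case).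
[cite: Dodson1987, Remark 4.7] [cite: Kubota1965, §4 Lemma 2] -/
theorem even_cmTypeRank_three (hK : Module.finrank ℚ K = 2 * 3 ^ k) (Φ : CMType K) : Even (cmTypeRank Φ) := by
  obtain ⟨hle, hdvd⟩ := sub_one_dvd_sub_cmTypeRank' Nat.prime_three (by norm_num) hK Φ
  have hodd : Odd (3 ^ k) := (by decide : Odd 3).pow
  obtain ⟨m, hm⟩ := hodd
  norm_num at hdvd
  obtain ⟨c, hc⟩ := hdvd
  exact ⟨(3 ^ k + 1) / 2 - c, by omega⟩

omit hp in
/-- **`p = 5`, degree `250` (e.g. `ℚ(ζ₂₅₁)`): every CM type has rank `≡ 2 (mod 4)`.** [cite: Kubota1965, §4 Lemma 2]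
[cite: Dodson1987, Remark 4.7] -/
theorem cmTypeRank_mod_four_twoHundredFifty (hK : Module.finrank ℚ K = 250) (Φ : CMType K) :
    cmTypeRank Φ % 4 = 2 := by
  have hK' : Module.finrank ℚ K = 2 * 5 ^ 3 := by rw [hK]; norm_num
  obtain ⟨hle, hdvd⟩ := sub_one_dvd_sub_cmTypeRank' (by norm_num : Nat.Prime 5) (by norm_num) hK' Φ
  norm_num at hle hdvd
  obtain ⟨c, hc⟩ := hdvd
  omega

end Field

end AbelianPrimePower

end Literature.AlgebraicGeometry.Pohlmann1968
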